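import Summits.Ventures.Crystal3D.LocalLP.LevyHeadline
import HarnessLib

/-!
# Bezdek's Conjecture 3.5 AS PRINTED, conditional on the Lévy–Schmidt fact

HONEST FRAMING. Part of the venture `Summits/Ventures/Crystal3D` (cell `pub-crystal3d`, CLAIMS row
B.35). K. Bezdek, *Contact numbers for congruent sphere packings in Euclidean 3-space*, Discrete
Comput. Geom. 48 (2012) 298–309, Conjecture 3.5 (= Conjecture 3.11 of arXiv:1102.1198v2, §3.2),
as rendered statement-exactly by the cell's literature seat (`lit/lean/BezdekConjecture35AsPrinted.lean`,
ratio cleared of its denominator): for `M` pairwise-disjoint OPEN spherical caps of angular radius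
`π/6` with unit centres `u₁, …, u_M` on `S²`,
`∑ₘ σ(C(uₘ, π/6)) ≤ 6 (1 - √3/2) · σ(⋃ₘ C(uₘ, π/3))`, `σ` = normalised area
(`Literature…sphereFraction`). This file PROVES it ASSUMING the Literature named fact
`Schmidt1948_sphericalIsoperimetric` (Lévy–Schmidt; classical, not proved in the tree): disjoint
open `π/6`-caps force pairwise angles `≥ π/3` (the bisecting direction would lie in both caps),
each open `π/6`-cap has `σ ≤ (1 - √3/2)/2` (inside the closed cap, Archimedes), and the covering
form `M/12 ≤ σ(⋃ open π/3-caps)` is `bezdek_conjecture35_covering`. Hence — conditionally on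
Lévy–Schmidt — Bezdek's conditional bound `C(n) < 6n - 1.8326 n^{2/3}` (his Thm 3.6 under
Conj. 3.5) becomes unconditional modulo that classical fact; the cell's own ladder is sharper.
No crystallization statement is claimed.
-/

noncomputable section

open scoped BigOperators RealInnerProductSpace
open Finset Real InnerProductGeometry Set

namespace Summit.Ventures.Crystal3D

open Literature.Geometry.DiscreteGeometry (sphereFraction sphCap Schmidt1948_sphericalIsoperimetric
  sphereFraction_mono sphereFraction_sphCap)

/-- **Disjoint open `π/6`-caps have centres at angle `≥ π/3`.** If `angle a b < π/3` for unit
vectors `a, b`, the direction of `a + b` lies in both open `π/6`-caps. -/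
theorem angle_ge_of_disjoint_openCaps {a b : EuclideanSpace ℝ (Fin 3)} (ha : ‖a‖ = 1)
    (hb : ‖b‖ = 1) (hdisj : Disjoint (sphOpenCap a (π / 6)) (sphOpenCap b (π / 6))) :
    π / 3 ≤ angle a b := by
  by_contra hlt
  have hlt' : angle a b < π / 3 := not_le.1 hlt
  -- `c = ⟪a, b⟫ > 1/2`
  have hc : 1 / 2 < ⟪a, b⟫ := by
    have hcos : cos (π / 3) < cos (angle a b) :=
      Real.cos_lt_cos_of_nonneg_of_le_pi (angle_nonneg a b) (by linarith [pi_pos]) hlt'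
    rwa [cos_angle, ha, hb, mul_one, div_one, cos_pi_div_three] at hcos
  -- the bisecting direction
  set s := a + b with hs
  have hs2 : ‖s‖ ^ 2 = 2 + 2 * ⟪a, b⟫ := by
    rw [hs, norm_add_sq_real, ha, hb]; ring
  have hspos : 0 < ‖s‖ := by
    have : 0 < ‖s‖ ^ 2 := by rw [hs2]; linarith
    nlinarith [norm_nonneg s]
  set w := ‖s‖⁻¹ • s with hw
  have hw1 : ‖w‖ = 1 := by
    rw [hw, norm_smul, norm_inv, norm_norm, inv_mul_cancel₀ hspos.ne']
  have hinner_a : ⟪a, s⟫ = 1 + ⟪a, b⟫ := by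
    rw [hs, inner_add_right, real_inner_self_eq_norm_sq, ha]; ring
  have hinner_b : ⟪b, s⟫ = 1 + ⟪a, b⟫ := by
    rw [hs, inner_add_right, real_inner_self_eq_norm_sq, hb, real_inner_comm]; ring
  -- `cos (angle x w) = (1 + c)/‖s‖ > √3/2`, so the angle is `< π/6`
  have key : ∀ x : EuclideanSpace ℝ (Fin 3), ‖x‖ = 1 → ⟪x, s⟫ = 1 + ⟪a, b⟫ → angle x w < π / 6 := by
    intro x hx hxs
    have hcosw : cos (angle x w) = (1 + ⟪a, b⟫) / ‖s‖ := by
      rw [cos_angle, hx, hw1, mul_one, div_one, hw, inner_smul_right, hxs]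
      field_simp
    -- compare with `cos (π/6) = √3/2` via squares
    have h3 : Real.sqrt 3 ^ 2 = 3 := Real.sq_sqrt (by norm_num)
    have hs3 : 0 ≤ Real.sqrt 3 := Real.sqrt_nonneg 3
    have hgt : Real.sqrt 3 / 2 < (1 + ⟪a, b⟫) / ‖s‖ := by
      rw [lt_div_iff₀ hspos]
      -- both sides positive; square
      have hlhs : 0 ≤ Real.sqrt 3 / 2 * ‖s‖ := by positivity
      have hsq : (Real.sqrt 3 / 2 * ‖s‖) ^ 2 < (1 + ⟪a, b⟫) ^ 2 := by
        rw [mul_pow, hs2]; nlinarith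
      nlinarith [hsq, hlhs]
    by_contra hge
    have hge' : π / 6 ≤ angle x w := not_lt.1 hge
    have hcos : cos (angle x w) ≤ cos (π / 6) :=
      Real.cos_le_cos_of_nonneg_of_le_pi (by positivity) (angle_le_pi _ _) hge'
    rw [hcosw, cos_pi_div_six] at hcos
    linarith
  have hwa : w ∈ sphOpenCap a (π / 6) := ⟨hw1, key a ha hinner_a⟩
  have hwb : w ∈ sphOpenCap b (π / 6) := ⟨hw1, key b hb hinner_b⟩
  exact Set.disjoint_left.1 hdisj hwa hwb

/-- An open `π/6`-cap has normalised area at most `(1 - √3/2)/2` (it lies in the closed cap). -/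
theorem sphereFraction_openCap_pi_div_six_le {a : EuclideanSpace ℝ (Fin 3)} (ha : ‖a‖ = 1) :
    sphereFraction (sphOpenCap a (π / 6)) ≤ (1 - Real.sqrt 3 / 2) / 2 := by
  have hsub : sphOpenCap a (π / 6) ⊆ sphCap a (π / 6) := fun v hv => ⟨hv.1, hv.2.le⟩
  refine (sphereFraction_mono hsub).trans ?_
  rw [sphereFraction_sphCap ha (by positivity) (by linarith [pi_pos]), cos_pi_div_six]

/-- **Bezdek's Conjecture 3.5 as printed** (conditional on the Lévy–Schmidt fact): for `M`
pairwise-disjoint open `π/6`-caps with unit centres `u₁, …, u_M`,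
`∑ₘ σ(C(uₘ, π/6)) ≤ 6(1 - √3/2) · σ(⋃ₘ C(uₘ, π/3))`. -/
theorem bezdek_conjecture35_asPrinted (hLevy : Schmidt1948_sphericalIsoperimetric)
    (M : ℕ) (u : Fin M → EuclideanSpace ℝ (Fin 3)) (hu : ∀ m, ‖u m‖ = 1)
    (hdisj : Pairwise fun m l => Disjoint (sphOpenCap (u m) (π / 6)) (sphOpenCap (u l) (π / 6))) :
    ∑ m, sphereFraction (sphOpenCap (u m) (π / 6)) ≤
      6 * (1 - Real.sqrt 3 / 2) * sphereFraction (⋃ m, sphOpenCap (u m) (π / 3)) := by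
  have hangle : Pairwise fun m l => π / 3 ≤ angle (u m) (u l) :=
    fun m l hml => angle_ge_of_disjoint_openCaps (hu m) (hu l) (hdisj hml)
  have hcov := bezdek_conjecture35_covering hLevy M u hu hangle
  have hsum : ∑ m, sphereFraction (sphOpenCap (u m) (π / 6)) ≤ (M : ℝ) * ((1 - Real.sqrt 3 / 2) / 2) :=
    calc ∑ m, sphereFraction (sphOpenCap (u m) (π / 6))
        ≤ ∑ _m : Fin M, (1 - Real.sqrt 3 / 2) / 2 :=
          Finset.sum_le_sum fun m _ => sphereFraction_openCap_pi_div_six_le (hu m)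
      _ = (M : ℝ) * ((1 - Real.sqrt 3 / 2) / 2) := by simp
  have h3 : Real.sqrt 3 < 2 := by
    have h : Real.sqrt 3 ^ 2 = 3 := Real.sq_sqrt (by norm_num)
    nlinarith [Real.sqrt_nonneg 3]
  have hpos : 0 < 1 - Real.sqrt 3 / 2 := by linarith
  nlinarith [hcov, hsum, hpos]

end Summit.Ventures.Crystal3D

end
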